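import Summits.CriticalPhenomena.SAWScalingLimit.Theorems.SAWSpinMonotoneSpinMonotoneAdjacentPortReduction

/-!
# `AdjacentPortWitness → ¬ SpinMonotone` (negative-modulo lemma of line `Sketch`, crux stmt-CriticalPhenomena-16769)

Route `SAWSpinMonotone`, crux `Summit.CriticalPhenomena.SAWScalingLimit.Theses.SAWSpinMonotone.SpinMonotone` (rank 2). By the
adjacent-port reduction (`adjacentPortInequality_of_spinMonotone`, file `…AdjacentPortReduction`), the crux forces the scalar
inequality `4·m(w₁)·m(q) ≤ m(p)·(m(w₁) + m(q))` between the three port masses at every target adjacent to the source vertex of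
every simply connected domain; hence ONE adjacent configuration violating it strictly (`AdjacentPortWitness`, vocabulary module
`…AdjacentPortDefs`) refutes the crux. The witness is not constructed here: exact transfer matrices on notched armchair strips
(card `Cruxes/SpinMonotone/Ideas/notched-strip-transfer-matrix.md`) give margins `0.0453 → 0.00296` for widths `2 → 11` on a
`W⁻²` law with a negative extrapolated limit, so a witness (if any) is a truncated strip of width `≈ 20` certified by directed
rounding — a computation attached to the item as evidence. Source: H. Duminil-Copin, S. Smirnov, Ann. of Math. 175 (2012),
arXiv:1007.0575, §1–2. Deliberately NOT here: any claim that the witness exists.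
-/

noncomputable section

namespace Summit.CriticalPhenomena.SAWScalingLimit.Cruxes.SpinMonotone.AdjacentPort

open Summit.CriticalPhenomena.SAWScalingLimit.Theses.SAWSpinMonotone (SpinMonotone)

/-- **`AdjacentPortWitness → ¬ SpinMonotone`**: a single adjacent configuration with `m(p)·(m(w₁)+m(q)) < 4·m(w₁)·m(q)`
contradicts the adjacent-port inequality that `SpinMonotone` forces. [cite: DuminilCopinSmirnov2012, Definition 1] -/
theorem SpinMonotone_false_of_AdjacentPortWitness : AdjacentPortWitness → ¬ SpinMonotone := by
  rintro ⟨Λ, u, w₁, v, p, q, hc, hlt⟩ hFM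
  exact absurd (adjacentPortInequality_of_spinMonotone hFM Λ u w₁ v p q hc) (not_le.2 hlt)

end Summit.CriticalPhenomena.SAWScalingLimit.Cruxes.SpinMonotone.AdjacentPort

end
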